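import Literature.Analysis.Complex.RiemannDomainCovering
import Literature.Analysis.Complex.BranchedCoveringCharPolySCV
import HarnessLib

/-!
# The characteristic polynomial of a flat-holomorphic function on a Riemann domain finite over `{δ ≠ 0}`

Layer `Literature/Analysis/Complex`. The Riemann-domain form of
`Literature/Analysis/Complex/BranchedCoveringCharPolySCV.lean` (Serre, GAGA n° 19 Lemme 8; SGA 1
XII Thm. 5.1, proof, part 2): let `proj : D → ℂ^ι` be a flat Riemann domain which is a covering
map with finite fibres over the complement `Ω = {δ ≠ 0}` of an algebraic hypersurface (`δ ≠ 0` a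
polynomial) — but, unlike the branched coverings of that file, NOT assumed proper over the
hypersurface, where the fibres of an étale algebraic chart escape to infinity — and let `h` be
flat-holomorphic on `D` with `|h| ≤ C₀ (1 + |proj|)^K`. Then there is a MONIC `R ∈ ℂ[z][τ]` with
`R(proj t)(h t) = 0` for all `t ∈ D` (`exists_charPoly_of_isCoveringMapOn`).

Proof, as in the branched case with two changes: the local simultaneous sections over a good value
come from the local TRIVIALISATIONS of the covering (instead of properness), along which `h` is
holomorphic because it is flat-holomorphic (`IsFlatHolomorphic.differentiableOn_comp_section`);
and the local boundedness of the symmetric functions near the hypersurface comes from the GLOBAL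
polynomial bound (instead of properness over the hypersurface). The symmetric functions then extend
across the thin set `{δ = 0}` (`SCV.exists_differentiableOn_eqOn_of_thin`), have polynomial
growth, hence are polynomials (`exists_mvPolynomial_of_growth`); the degree is constant because
`{δ ≠ 0}` is connected (`isPreconnected_setOf_eval_ne_zero`); and the root relation passes from the
dense open `proj⁻¹{δ ≠ 0}` (`proj` is open) to `D` by continuity.

Everything is proved; there are no named facts.

## References

* J.-P. Serre, *Géométrie algébrique et géométrie analytique*, Ann. Inst. Fourier 6 (1956), n° 19
  Lemme 8, n° 20. [SerreGAGA1956]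
* A. Grothendieck, M. Raynaud, *SGA 1*, Exp. XII Thm. 5.1, proof, part 2. [SGA1]

#harness_tags complex_analysis.several_variables, complex_geometry.riemann_existence, algebraic_geometry.sga1
-/

noncomputable section

open scoped Topology Polynomial
open Set Filter Function Polynomial Metric

namespace Literature.Analysis.Complex

namespace RiemannDomain

universe u

variable {ι : Type} [Fintype ι] {D : RiemannDomain.{u} ι}

open BranchedCoveringSCV in
/-- **The characteristic polynomial of a flat-holomorphic function of polynomial growth along a
Riemann domain finite over `{δ ≠ 0}`** (Serre, GAGA n° 19 Lemme 8, in the form needed for SGA 1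
XII 5.1 in all dimensions): see the module docstring. [cite: SerreGAGA1956, n° 19 Lemme 8]
[cite: SGA1, Exp. XII Thm. 5.1 (p. 333), proof, part 2] -/
theorem exists_charPoly_of_isCoveringMapOn {δ : MvPolynomial ι ℂ} (hδ : δ ≠ 0)
    (hcov : IsCoveringMapOn D.proj {z | MvPolynomial.eval z δ ≠ 0})
    (hfin : ∀ z, MvPolynomial.eval z δ ≠ 0 → (D.proj ⁻¹' {z}).Finite)
    {h : D → ℂ} (hh : IsFlatHolomorphic D h)
    {C₀ : ℝ} {K : ℕ} (hgrowth : ∀ t, ‖h t‖ ≤ C₀ * (1 + ‖D.proj t‖) ^ K) :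
    ∃ R : Polynomial (MvPolynomial ι ℂ), R.Monic ∧
      ∀ t, (R.map (MvPolynomial.eval (D.proj t))).eval (h t) = 0 := by
  classical
  set F : D → ι → ℂ := D.proj with hFdef
  have hF : Continuous F := D.isLocalHomeomorph.continuous
  have hhc : Continuous h := hh.continuous
  -- the hypersurface `Δ` and its complement
  set ev : (ι → ℂ) → ℂ := fun z ↦ MvPolynomial.eval z δ with hev
  have hevc : Continuous ev := (differentiable_eval δ).continuous
  set Δ : Set (ι → ℂ) := {z | ev z = 0} with hΔ
  have hΔclosed : IsClosed Δ := isClosed_eq hevc continuous_const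
  have hSopen : IsOpen Δᶜ := hΔclosed.isOpen_compl
  have hS_eq : Δᶜ = {z | MvPolynomial.eval z δ ≠ 0} := rfl
  have hSdense : Dense Δᶜ := dense_setOf_eval_ne_zero hδ
  have hSconn : IsPreconnected Δᶜ := isPreconnected_setOf_eval_ne_zero δ
  -- fibres, the fibrewise polynomial and its coefficients
  set fib : (ι → ℂ) → Finset D := fun z ↦ if hz : MvPolynomial.eval z δ ≠ 0 then (hfin z hz).toFinset else ∅
    with hfib_def
  have hfib : ∀ z, z ∈ Δᶜ → ∀ t, t ∈ fib z ↔ F t = z := fun z hz t ↦ by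
    have hz' : MvPolynomial.eval z δ ≠ 0 := hz
    simp only [hfib_def, dif_pos hz', Finite.mem_toFinset, mem_preimage, mem_singleton_iff, hFdef]
  set p : (ι → ℂ) → ℂ[X] := fun z ↦ ∏ t ∈ fib z, (X - C (h t)) with hp_def
  set σ : ℕ → (ι → ℂ) → ℂ := fun k z ↦ (p z).coeff k with hσ_def
  have hp_monic : ∀ z, (p z).Monic := fun z ↦ monic_prod_X_sub_C _ _
  have hp_deg : ∀ z, (p z).natDegree = (fib z).card := fun z ↦ natDegree_finsetProd_X_sub_C_eq_card _ _
  -- local structure over a good value: the sheets of a local trivialisation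
  have hlocal : ∀ z, z ∈ Δᶜ → ∃ V : Set (ι → ℂ), IsOpen V ∧ z ∈ V ∧
      ∃ (I : Type u) (_ : Fintype I) (sh : I → (ι → ℂ) → D),
        (∀ i, DifferentiableOn ℂ (fun z' ↦ h (sh i z')) V) ∧
        ∀ z' ∈ V, p z' = ∏ i, (X - C (h (sh i z'))) ∧ (fib z').card = Fintype.card I := by
    intro z hz
    obtain ⟨_, U, hzU, hUo, hUo', H, hH⟩ := hcov z hz
    haveI : Fintype (D.proj ⁻¹' {z}) := (hfin z hz).fintype
    set V : Set (ι → ℂ) := U ∩ Δᶜ with hV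
    have hVo : IsOpen V := hUo.inter hSopen
    -- the sheets
    set sh : (D.proj ⁻¹' {z}) → (ι → ℂ) → D := fun i z' ↦
      if hz' : z' ∈ U then (H.symm (⟨z', hz'⟩, i) : D) else (i : D) with hsh
    have hsh_proj : ∀ i, ∀ z' ∈ U, D.proj (sh i z') = z' := fun i z' hz' ↦ by
      simp only [hsh, dif_pos hz']
      have := hH (H.symm (⟨z', hz'⟩, i))
      rw [H.apply_symm_apply] at this
      exact this.symm
    have hsh_cont : ∀ i, ContinuousOn (sh i) U := fun i ↦ by
      rw [continuousOn_iff_continuous_restrict]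
      have : U.restrict (sh i) = fun z' : U ↦ (H.symm (z', i) : D) := by
        funext z'; simp [hsh]
      rw [this]
      fun_prop
    -- the fibre over `z' ∈ U` is `{sh i z'}` without repetition
    have hsh_inj : ∀ z' ∈ U, Function.Injective fun i ↦ sh i z' := fun z' hz' i j hij ↦ by
      simp only [hsh, dif_pos hz'] at hij
      have := H.symm.injective (Subtype.ext hij)
      simpa using this
    have hsh_fib : ∀ z' ∈ V, fib z' = Finset.univ.image fun i ↦ sh i z' := by
      intro z' hz'
      ext y
      rw [hfib z' hz'.2, Finset.mem_image]
      constructor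
      · intro hy
        have hyU : y ∈ D.proj ⁻¹' U := by rw [mem_preimage, ← hFdef, hy]; exact hz'.1
        refine ⟨(H ⟨y, hyU⟩).2, Finset.mem_univ _, ?_⟩
        simp only [hsh, dif_pos hz'.1]
        have h1 : (H ⟨y, hyU⟩).1 = ⟨z', hz'.1⟩ := Subtype.ext (by rw [hH]; exact hy)
        have h2 : H.symm ((H ⟨y, hyU⟩).1, (H ⟨y, hyU⟩).2) = ⟨y, hyU⟩ := by
          rw [Prod.mk.eta, H.symm_apply_apply]
        rw [h1] at h2
        exact congrArg Subtype.val h2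
      · rintro ⟨i, -, rfl⟩
        exact hsh_proj i z' hz'.1
    refine ⟨V, hVo, ⟨hzU, hz⟩, D.proj ⁻¹' {z}, inferInstance, sh, fun i ↦ ?_, fun z' hz' ↦ ⟨?_, ?_⟩⟩
    · exact (hh.differentiableOn_comp_section hUo (hsh_cont i) (hsh_proj i)).mono inter_subset_left
    · simp only [hp_def, hsh_fib z' hz']
      rw [Finset.prod_image fun i _ j _ hij ↦ hsh_inj z' hz'.1 hij]
    · rw [hsh_fib z' hz', Finset.card_image_of_injective _ (hsh_inj z' hz'.1), Finset.card_univ]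
  -- holomorphy of the coefficients off `Δ`
  have hσdiff : ∀ k, DifferentiableOn ℂ (σ k) Δᶜ := by
    intro k z hz
    obtain ⟨V, hVopen, hzV, I, _, sh, hdiffV, hV⟩ := hlocal z hz
    have h1 : DifferentiableOn ℂ (fun z' ↦ (∏ i ∈ (Finset.univ : Finset I), (X - C (h (sh i z')))).coeff k) V :=
      differentiableOn_coeff_prod_X_sub_C Finset.univ (a := fun i z' ↦ h (sh i z')) (fun i _ ↦ hdiffV i) k
    have h2 : DifferentiableAt ℂ (σ k) z := by
      refine ((h1 z hzV).differentiableAt (hVopen.mem_nhds hzV)).congr_of_eventuallyEq ?_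
      filter_upwards [hVopen.mem_nhds hzV] with z' hz'
      simp only [hσ_def, (hV z' hz').1]
    exact h2.differentiableWithinAt
  -- constancy of the fibre cardinality off `Δ`
  obtain ⟨z₀, hz₀⟩ := hSdense.nonempty
  set n : ℕ := (fib z₀).card with hn_def
  have hcard : ∀ z, z ∈ Δᶜ → (fib z).card = n := by
    intro z hz
    refine hSconn.constant (f := fun z ↦ (fib z).card) ?_ hz hz₀
    intro w hw
    obtain ⟨V, hVopen, hwV, I, _, sh, -, hV⟩ := hlocal w hw
    have hc : ContinuousAt (fun z ↦ (fib z).card) w := by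
      refine (continuousAt_const (y := (fib w).card)).congr_of_eventuallyEq ?_
      filter_upwards [hVopen.mem_nhds hwV] with z' hz'
      show (fib z').card = (fib w).card
      rw [(hV z' hz').2, (hV w hwV).2]
    exact hc.continuousWithinAt
  -- the coefficient bound
  have hσbound : ∀ k z, ‖σ k z‖ ≤ ∏ t ∈ fib z, (1 + ‖h t‖) := fun k z ↦
    BranchedCovering.norm_coeff_prod_X_sub_C_le _ _ _
  have hprod_le : ∀ (z : ι → ℂ) (B : ℝ), 0 ≤ B → (∀ t ∈ fib z, ‖h t‖ ≤ B) →
      ∏ t ∈ fib z, (1 + ‖h t‖) ≤ (1 + B) ^ (fib z).card := by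
    intro z B hB hle
    calc ∏ t ∈ fib z, (1 + ‖h t‖) ≤ ∏ _t ∈ fib z, (1 + B) :=
          Finset.prod_le_prod (fun _ _ ↦ by positivity) fun t ht ↦ by linarith [hle t ht]
      _ = (1 + B) ^ (fib z).card := Finset.prod_const _
  -- the global polynomial bound off `Δ`
  set C' : ℝ := max C₀ 0 with hC'
  have hσglobal : ∀ k z, z ∈ Δᶜ → ‖σ k z‖ ≤ (1 + C') ^ n * (1 + ‖z‖) ^ (K * n) := by
    intro k z hz
    have hle : ∀ t ∈ fib z, ‖h t‖ ≤ C' * (1 + ‖z‖) ^ K := fun t ht ↦ by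
      rw [← (hfib z hz t).1 ht]
      exact (hgrowth t).trans (mul_le_mul_of_nonneg_right (le_max_left _ _) (by positivity))
    calc ‖σ k z‖ ≤ ∏ t ∈ fib z, (1 + ‖h t‖) := hσbound k z
      _ ≤ (1 + C' * (1 + ‖z‖) ^ K) ^ (fib z).card := hprod_le z _ (by positivity) hle
      _ ≤ ((1 + C') * (1 + ‖z‖) ^ K) ^ (fib z).card := by
          gcongr
          have h1 : (1 : ℝ) ≤ (1 + ‖z‖) ^ K := one_le_pow₀ (by linarith [norm_nonneg z])
          nlinarith [le_max_right C₀ 0]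
      _ = (1 + C') ^ n * (1 + ‖z‖) ^ (K * n) := by rw [hcard z hz, mul_pow, ← pow_mul]
  -- local boundedness near the points of `Δ` (from the global bound)
  have hσnear : ∀ k, ∀ c ∈ Δ ∩ univ, ∃ W ∈ 𝓝 c, ∃ Bd : ℝ, ∀ z ∈ W \ Δ, ‖σ k z‖ ≤ Bd := by
    intro k c _
    refine ⟨ball c 1, ball_mem_nhds c one_pos, (1 + C') ^ n * (2 + ‖c‖) ^ (K * n), fun z hz ↦ ?_⟩
    have hzS : z ∈ Δᶜ := hz.2
    have hz1 : ‖z‖ ≤ ‖c‖ + 1 := by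
      have := mem_ball_iff_norm.1 hz.1
      linarith [norm_le_norm_add_norm_sub' z c, norm_sub_rev z c]
    calc ‖σ k z‖ ≤ (1 + C') ^ n * (1 + ‖z‖) ^ (K * n) := hσglobal k z hzS
      _ ≤ (1 + C') ^ n * (2 + ‖c‖) ^ (K * n) :=
          mul_le_mul_of_nonneg_left (pow_le_pow_left₀ (by positivity) (by linarith) _) (by positivity)
  -- thinness of `Δ` in the sense of the Riemann extension theorem
  have hthin : ∀ a ∈ Δ ∩ univ, ∃ (φ : (ι → ℂ) → ℂ) (W : Set (ι → ℂ)), IsOpen W ∧ a ∈ W ∧ W ⊆ univ ∧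
      DifferentiableOn ℂ φ W ∧ (∀ x ∈ Δ ∩ W, φ x = 0) ∧ ¬ φ =ᶠ[𝓝 a] 0 := by
    intro a _
    refine ⟨ev, univ, isOpen_univ, mem_univ a, Subset.rfl, (differentiable_eval δ).differentiableOn,
      fun x hx ↦ hx.1, fun hzero ↦ hδ (eq_zero_of_eventuallyEq_zero hzero)⟩
  -- the entire extensions of the coefficients and their growth
  have hG : ∀ k, ∃ G : (ι → ℂ) → ℂ, Differentiable ℂ G ∧ EqOn G (σ k) Δᶜ ∧
      ∀ q, ‖G q‖ ≤ (1 + C') ^ n * (1 + ‖q‖) ^ (K * n) := by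
    intro k
    have hUA : IsOpen (univ \ Δ) := by rw [← compl_eq_univ_sdiff]; exact hSopen
    obtain ⟨G, hGd, hGeq⟩ := SCV.exists_differentiableOn_eqOn_of_thin (f := σ k) hUA hthin
      (by rw [← compl_eq_univ_sdiff]; exact hσdiff k) (hσnear k)
    rw [← compl_eq_univ_sdiff] at hGeq
    have hGd' : Differentiable ℂ G := differentiableOn_univ.1 hGd
    refine ⟨G, hGd', hGeq, ?_⟩
    have hclosed : IsClosed {q : ι → ℂ | ‖G q‖ ≤ (1 + C') ^ n * (1 + ‖q‖) ^ (K * n)} :=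
      isClosed_le hGd'.continuous.norm (by fun_prop)
    have hsub : Δᶜ ⊆ {q : ι → ℂ | ‖G q‖ ≤ (1 + C') ^ n * (1 + ‖q‖) ^ (K * n)} := fun q hq ↦ by
      show ‖G q‖ ≤ _
      rw [hGeq hq]
      exact hσglobal k q hq
    intro q
    exact hclosed.closure_subset_iff.2 hsub (hSdense q)
  -- the coefficients are polynomials
  have hpoly : ∀ k, ∃ g : MvPolynomial ι ℂ, ∀ z, z ∈ Δᶜ → MvPolynomial.eval z g = σ k z := by
    intro k
    obtain ⟨G, hGd, hGeq, hGb⟩ := hG k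
    obtain ⟨g, -, hg⟩ := exists_mvPolynomial_of_growth hGd hGb
    exact ⟨g, fun z hz ↦ by rw [hg z, hGeq hz]⟩
  choose g hg using hpoly
  -- the characteristic polynomial
  set R : Polynomial (MvPolynomial ι ℂ) := ∑ k ∈ Finset.range (n + 1), C (g k) * X ^ k with hR
  have hRcoeff : ∀ k, R.coeff k = if k ∈ Finset.range (n + 1) then g k else 0 := by
    intro k
    simp only [hR, finsetSum_coeff, coeff_C_mul_X_pow]
    rw [Finset.sum_ite_eq]
  have hRmap : ∀ z, z ∈ Δᶜ → R.map (MvPolynomial.eval z) = p z := by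
    intro z hz
    ext k
    rw [coeff_map, hRcoeff]
    split_ifs with hk
    · rw [hg k z hz]
    · rw [Finset.mem_range, not_lt] at hk
      rw [map_zero]
      symm
      apply coeff_eq_zero_of_natDegree_lt
      rw [hp_deg, hcard z hz]
      omega
  have hgn : g n = 1 := by
    apply MvPolynomial.funext
    intro z
    rw [map_one]
    have hclosed : IsClosed {z : ι → ℂ | MvPolynomial.eval z (g n) = 1} :=
      isClosed_eq (differentiable_eval (g n)).continuous continuous_const
    refine hclosed.closure_subset_iff.2 (fun w hw ↦ ?_) (hSdense z)
    show MvPolynomial.eval w (g n) = 1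
    rw [hg n w hw]
    show (p w).coeff n = 1
    have h := (hp_monic w).coeff_natDegree
    rwa [hp_deg, hcard w hw] at h
  have hRmonic : R.Monic := by
    refine monic_of_natDegree_le_of_coeff_eq_one n ?_ ?_
    · refine natDegree_sum_le_of_forall_le _ _ fun k hk ↦ ?_
      refine (natDegree_C_mul_X_pow_le _ _).trans ?_
      rw [Finset.mem_range] at hk
      omega
    · rw [hRcoeff, if_pos (Finset.self_mem_range_succ n), hgn]
  refine ⟨R, hRmonic, ?_⟩
  -- the root property off `proj⁻¹(Δ)` ...
  have hroot : ∀ t, F t ∈ Δᶜ → (R.map (MvPolynomial.eval (F t))).eval (h t) = 0 := by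
    intro t ht
    rw [hRmap (F t) ht, hp_def]
    simp only [eval_prod, eval_sub, eval_X, eval_C]
    exact Finset.prod_eq_zero ((hfib (F t) ht t).2 rfl) (sub_self _)
  -- ... and everywhere, by density (`proj` is open, `Δᶜ` is dense) and continuity
  have hdense : Dense {t : D | F t ∈ Δᶜ} := hSdense.preimage D.isLocalHomeomorph.isOpenMap
  have hcont : Continuous fun t ↦ (R.map (MvPolynomial.eval (F t))).eval (h t) := by
    have heq : ∀ t, (R.map (MvPolynomial.eval (F t))).eval (h t) =
        ∑ k ∈ Finset.range (n + 1), MvPolynomial.eval (F t) (g k) * h t ^ k := by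
      intro t
      simp only [hR, Polynomial.map_sum, Polynomial.map_mul, map_C, Polynomial.map_pow, map_X,
        eval_finsetSum, eval_mul, eval_C, eval_pow, eval_X]
    simp_rw [heq]
    exact continuous_finsetSum _ fun k _ ↦
      (((differentiable_eval (g k)).continuous).comp hF).mul (hhc.pow k)
  have hzero : (fun t ↦ (R.map (MvPolynomial.eval (F t))).eval (h t)) = fun _ ↦ 0 :=
    Continuous.ext_on hdense hcont continuous_const fun t ht ↦ hroot t ht
  exact fun t ↦ congr_fun hzero t

end RiemannDomain

end Literature.Analysis.Complex
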